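import Summits.KontsevichZagierPeriods.KontsevichZagierPeriods.Theorems.GrothendieckSectorComplementStubJointKernel

/-!
# Containment joins are free: the saturation lemma in the formal period ring
# (stub `stub_saturationKernel`, line `containment-join` (ring level), crux `Grothendieck.SectorComplement`,
# stmt-KontsevichZagierPeriods-11102)

In the formal period ring `P = FormalRep ⧸ relations` of the Kontsevich–Zagier calculus, Conjecture 1
on a sector is injectivity of the evaluation `evalP : P →+* ℝ` on a subring. This file lands the
pure-algebra SATURATION LEMMA: if `evalP` is injective on a subring `R₀` and every new generator
`t ∈ T` has a non-zero integer multiple `n • t ∈ R₀`, then `evalP` is injective on the subring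
generated by `R₀ ∪ T`. Proof: every element `x` of that subring has a non-zero multiple `n • x ∈ R₀`
(induction on the closure); if `evalP x = 0` then `evalP (n • x) = 0`, so `n • x = 0` by the
hypothesis on `R₀`, and `P` is torsion-free (integer division is a derived rule of the calculus,
`mem_relations_of_nsmul_mem`), so `x = 0`.

References: M. Kontsevich, D. Zagier, *Periods* (2001), §1.2, §4.1.
-/

noncomputable section

open MeasureTheory Set
open Literature.NumberTheory.Transcendental
open Literature.NumberTheory.Transcendental.KZ
open Summit.KontsevichZagierPeriods.MzvKernelInKZ.Negative

namespace Summit.KontsevichZagierPeriods.Grothendieck.SectorComplementRingJoin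

/-- **The formal period ring is torsion-free**: `n • x = 0` with `n ≠ 0` forces `x = 0` in
`P = FormalRep ⧸ relations` (integer division is a derived rule of the calculus,
`mem_relations_of_nsmul_mem`). [folklore] -/
theorem eq_zero_of_nsmul_eq_zero_formalPeriod {n : ℕ} (hn : n ≠ 0) {x : FormalPeriodRing}
    (h : n • x = 0) : x = 0 := by
  obtain ⟨c, rfl⟩ := toFormalPeriod_surjective x
  rw [← map_nsmul, toFormalPeriod_eq_zero_iff] at h
  exact toFormalPeriod_eq_zero_iff.mpr (mem_relations_of_nsmul_mem (Nat.pos_of_ne_zero hn) h)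

/-- **Saturation of a subring by torsion generators**: if every `t ∈ T` has a non-zero integer
multiple in the subring `R₀`, then so does every element of the subring generated by `R₀ ∪ T`.
[folklore] -/
theorem exists_nsmul_mem_of_mem_closure (R₀ : Subring FormalPeriodRing) (T : Set FormalPeriodRing)
    (hT : ∀ t ∈ T, ∃ n : ℕ, n ≠ 0 ∧ n • t ∈ R₀) {x : FormalPeriodRing}
    (hx : x ∈ Subring.closure ((R₀ : Set FormalPeriodRing) ∪ T)) :
    ∃ n : ℕ, n ≠ 0 ∧ n • x ∈ R₀ := by
  induction hx using Subring.closure_induction with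
  | mem x hx =>
    rcases hx with hx | hx
    · exact ⟨1, one_ne_zero, by rwa [one_nsmul]⟩
    · exact hT x hx
  | zero => exact ⟨1, one_ne_zero, by rw [nsmul_zero]; exact R₀.zero_mem⟩
  | one => exact ⟨1, one_ne_zero, by rw [one_nsmul]; exact R₀.one_mem⟩
  | add x y _ _ hx hy =>
    obtain ⟨n, hn, hnx⟩ := hx
    obtain ⟨m, hm, hmy⟩ := hy
    refine ⟨n * m, mul_ne_zero hn hm, ?_⟩
    have e : (n * m) • (x + y) = m • (n • x) + n • (m • y) := by
      rw [nsmul_add, mul_nsmul, mul_nsmul']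
    rw [e]
    exact R₀.add_mem (R₀.nsmul_mem hnx m) (R₀.nsmul_mem hmy n)
  | neg x _ hx =>
    obtain ⟨n, hn, hnx⟩ := hx
    refine ⟨n, hn, ?_⟩
    rw [smul_neg]
    exact R₀.neg_mem hnx
  | mul x y _ _ hx hy =>
    obtain ⟨n, hn, hnx⟩ := hx
    obtain ⟨m, hm, hmy⟩ := hy
    refine ⟨n * m, mul_ne_zero hn hm, ?_⟩
    have e : (n * m) • (x * y) = (n • x) * (m • y) := by
      simp only [nsmul_eq_mul, Nat.cast_mul]
      ring
    rw [e]
    exact R₀.mul_mem hnx hmy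

/-- STUB S1 (registered `stub_saturationKernel`): **containment joins are free.** If `evalP` is
injective on a subring `R₀` of the formal period ring and every new generator `t ∈ T` has a non-zero
integer multiple in `R₀`, then `evalP` is injective on the subring generated by `R₀ ∪ T`: for `x` in
that subring pick `n ≠ 0` with `n • x ∈ R₀` (`exists_nsmul_mem_of_mem_closure`); `evalP x = 0`
gives `evalP (n • x) = n • evalP x = 0`, hence `n • x = 0`, hence `x = 0` by torsion-freeness of
`P` (`eq_zero_of_nsmul_eq_zero_formalPeriod`). [folklore] -/
theorem stub_saturationKernel :
    ∀ (R₀ : Subring FormalPeriodRing) (T : Set FormalPeriodRing),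
      (∀ x ∈ R₀, evalP x = 0 → x = 0) →
      (∀ t ∈ T, ∃ n : ℕ, n ≠ 0 ∧ n • t ∈ R₀) →
      ∀ x ∈ Subring.closure ((R₀ : Set FormalPeriodRing) ∪ T), evalP x = 0 → x = 0 := by
  intro R₀ T hR₀ hT x hx hx0
  obtain ⟨n, hn, hnx⟩ := exists_nsmul_mem_of_mem_closure R₀ T hT hx
  have h0 : evalP (n • x) = 0 := by rw [map_nsmul, hx0, nsmul_zero]
  exact eq_zero_of_nsmul_eq_zero_formalPeriod hn (hR₀ _ hnx h0)

end Summit.KontsevichZagierPeriods.Grothendieck.SectorComplementRingJoin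

end
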